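import Summits.Ventures.YMGap.Census.OneLinkConfiguration
import HarnessLib

/-!
# Venture YMGap, track (b) — the potential-moving step is STRICT in `d ≥ 3`
# (Tomboulis, arXiv:0707.2179, App. A §4 with the «equality only in the trivial case» clause; the input of §3.2 (3.23))

HONEST FRAMING: venture file of the cell `pub-ymgap` (QuantumFields programme), track (b); finite tori `(ℤ/bLℤ)^d` only, on
the positivity domain `f_c ≥ 0` of the plaquette function; nothing about (5.15), limits, confinement or a mass gap.

`PotentialMoving.powFieldZ_le_powFieldZ_moveExp` proves Tomboulis's elementary move `Z(e) ≤ Z(move_κ e)` (App. A §4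
(A.15)–(A.18)) by pointwise AM–GM over the `b` cyclic `κ`-translates plus translation invariance.  Here the FIRST move
(from `e ≡ 1`) is shown to be STRICT for `d ≥ 3`, `b ≥ 2` as soon as one coefficient `c_n` is positive:
* `restFn_oneLink_pos` — the untouched factor is positive at the one-link configuration;
* **`powFieldZ_one_lt_moveExp`** — `Z(1) < Z(move_κ 1)` (`κ` the third direction): at the one-link configuration
  `U_{(0,e_0)} = g₁`, `0 < f(g₁) ≠ f(1)` (`OneLinkConfiguration.exists_plaqFn_pos_ne_one`), the slices `x_κ ≡ 0` and
  `x_κ ≡ 1 (mod b)` carry different products (`sliceFn_oneLink_zero_ne` / `sliceFn_oneLink_of_ne`), so the AM–GM step is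
  strict there (`Real.geom_mean_lt_arith_mean_weighted_iff_of_pos`); the gap is continuous and `≥ 0` everywhere, and the
  product Haar measure charges open sets (`Continuous.integral_pos_of_hasCompactSupport_nonneg_nonzero`);
* **`torusZ_fine_lt_powFieldZ_mkExp`** — STRICT potential moving:
  `Z_{(ℤ/bL)^d}({c_j}) < ∫ ∏_{p on the coarse 2-skeleton} f_c(U_p)^{b^{d-2}} ∏ dU` for `d ≥ 3`, `b ≥ 2`, every `L ≥ 1`, `J`,
  all `c_n ≥ 0` with `f_c ≥ 0` and some `c_n > 0` (first move strict, the remaining moves by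
  `OneLinkConfiguration.powFieldZ_mkExpS_le_univ`).
In `d = 2` there is no direction perpendicular to a plaquette and the decimation is exact (`TwoDimDecimation`): the
hypothesis `d ≥ 3` is sharp.

References: E. T. Tomboulis, arXiv:0707.2179, App. A §4 (A.14)–(A.19), Prop. III.1 and §3.2 (3.23)
[cite: Tomboulis2007Confinement, App. A §4]; potential moving: Migdal 1975 / Kadanoff 1976 [folklore].
-/

noncomputable section

open MeasureTheory Finset Real Function
open scoped BigOperators
open Literature.MathematicalPhysics.QuantumLattice
open Literature.MathematicalPhysics.QuantumFieldTheory
open Literature.MathematicalPhysics.QuantumFieldTheory.Tomboulis2007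
open Literature.MathematicalPhysics.QuantumFieldTheory.WilsonRP
open Summit.Ventures.LatticeQCDFlow.Exactness
open Summit.Ventures.LatticeQCDFlow.Scoring

namespace Summit.Ventures.YMGap.Census

variable {d L : ℕ}

/-! ### The strict first move and the strict potential-moving bound -/

section StrictMove

variable (b : ℕ) [NeZero b] [NeZero L]

omit [NeZero b] [NeZero L] in
/-- The residue of `0` is `0` (plumbing). -/
theorem resb_zero : resb b L (0 : ZMod (b * L)) = 0 := map_zero _

/-- **The rest factor of the one-link configuration is positive** (`f(1), f(g) > 0`). -/
theorem restFn_oneLink_pos (hb : 2 ≤ b) (J : ℕ) {c : ℕ → ℝ} (κ : Fin d) (e : Plaquette d (b * L) → ℕ) (e₀ : Edge d (b * L))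
    {g : SU2} (h1 : 0 < plaqFn J c 1) (hg : 0 < plaqFn J c g) : 0 < restFn b J c κ e (oneLink e₀ g) := by
  haveI := fact_one_lt_mul_side (L := L) b hb
  unfold restFn
  exact Finset.prod_pos fun p _ => pow_pos (fR_oneLink_pos J e₀ h1 hg p) _

/-- **THE FIRST MOVE IS STRICT** (arXiv:0707.2179 App. A §4 — the convex interpolation `ξ ↦ Z(ξ)` is not constant):
for `d ≥ 3`, `b ≥ 2`, on the positivity domain and with one coefficient `c_n > 0`,
`Z(1) < Z(move_κ 1)` for the move along the third direction `κ = 2`.  Mechanism: at the one-link configuration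
`U_{(0, e_0)} = g₁` (`0 < f(g₁) ≠ f(1)`) the `κ`-slices `x_κ ≡ 0` and `x_κ ≡ 1 (mod b)` of the plaquettes `⊥ κ`
carry different products, so AM–GM over the `b` cyclic translates is strict there; the gap is continuous and
`≥ 0`, and the product Haar measure charges open sets. -/
theorem powFieldZ_one_lt_moveExp (hd : 3 ≤ d) (hb : 2 ≤ b) (J : ℕ) {c : ℕ → ℝ} (hc : ∀ n, 1 ≤ n → 0 ≤ c n)
    (hf : ∀ g : SU2, 0 ≤ plaqFn J c g) {n₀ : ℕ} (hn₀ : n₀ ∈ Icc 1 J) (hpos : 0 < c n₀) :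
    powFieldZ J c (fun _ : Plaquette d (b * L) => 1) <
      powFieldZ J c (moveExp b (⟨2, by omega⟩ : Fin d) (fun _ : Plaquette d (b * L) => 1)) := by
  haveI := fact_one_lt_mul_side (L := L) b hb
  haveI : Fact (1 < b) := ⟨by omega⟩
  set κ : Fin d := ⟨2, by omega⟩ with hκdef
  set μ : Fin d := ⟨0, by omega⟩ with hμdef
  set ν : Fin d := ⟨1, by omega⟩ with hνdef
  have hμν : μ < ν := Fin.mk_lt_mk.2 (by norm_num)
  have hκμ : κ ≠ μ := by simp [hκdef, hμdef, Fin.ext_iff]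
  have hκν : κ ≠ ν := by simp [hκdef, hνdef, Fin.ext_iff]
  obtain ⟨g₁, hg₁, hg₁ne⟩ := exists_plaqFn_pos_ne_one hc hn₀ hpos
  have h1 : 0 < plaqFn J c 1 := zero_lt_one.trans (one_lt_plaqFn_one hc hn₀ hpos)
  set W₀ : GaugeConfig d (b * L) SU2 := oneLink ((0 : Site d (b * L)), μ) g₁ with hW₀
  set e : Plaquette d (b * L) → ℕ := fun _ => 1 with he
  set P : Measure (GaugeConfig d (b * L) SU2) := Measure.pi fun _ : Edge d (b * L) => haarProbability SU2 with hP
  have hint : ∀ e' : Plaquette d (b * L) → ℕ, Integrable (powFieldFn J c e') P :=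
    fun e' => integrable_pi_su2_of_continuous (continuous_powFieldFn J c e')
  -- the AM–GM gap, pointwise `≥ 0` and continuous
  set G : GaugeConfig d (b * L) SU2 → ℝ :=
    fun W => ∑ i : ZMod b, (b : ℝ)⁻¹ * powFieldFn J c (sliceExp b κ e i) W - powFieldFn J c e W with hG
  have hGc : Continuous G :=
    (continuous_finsetSum _ fun i _ => continuous_const.mul (continuous_powFieldFn J c _)).sub
      (continuous_powFieldFn J c e)
  have hG0 : ∀ W, 0 ≤ G W := fun W => sub_nonneg.2 (powFieldFn_le_avg_slice b J hf κ e W)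
  -- strictness at the one-link configuration
  have hGW₀ : 0 < G W₀ := by
    have hb0 : (b : ℝ) ≠ 0 := Nat.cast_ne_zero.2 (NeZero.ne b)
    have hS : ∀ i, 0 ≤ sliceFn b J c κ e i W₀ := fun i =>
      Finset.prod_nonneg fun p _ => pow_nonneg (fR_oneLink_pos J _ h1 hg₁ p).le _
    -- the two slices `0` and `1` differ
    have hne : sliceFn b J c κ e 0 W₀ ≠ sliceFn b J c κ e 1 W₀ := by
      rw [he, hW₀, sliceFn_oneLink_of_ne b J c κ μ g₁ (one_ne_zero : (1 : ZMod b) ≠ 0),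
        ← card_sliceSet_zero_eq_one b κ]
      exact sliceFn_oneLink_zero_ne b hb J hμν hκμ hκν h1 hg₁ hg₁ne
    have hne' : sliceFn b J c κ e 0 W₀ ^ b ≠ sliceFn b J c κ e 1 W₀ ^ b := fun h =>
      hne ((pow_left_inj₀ (hS 0) (hS 1) (NeZero.ne b)).1 h)
    -- strict AM–GM with equal weights
    have hamgm := (Real.geom_mean_lt_arith_mean_weighted_iff_of_pos (Finset.univ : Finset (ZMod b))
      (fun _ => (b : ℝ)⁻¹) (fun i => sliceFn b J c κ e i W₀ ^ b) (fun _ _ => by positivity)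
      (by rw [Finset.sum_const, Finset.card_univ, ZMod.card, nsmul_eq_mul, mul_inv_cancel₀ hb0])
      (fun i _ => pow_nonneg (hS i) b)).2 ⟨0, Finset.mem_univ _, 1, Finset.mem_univ _, hne'⟩
    have hgeo : ∏ i : ZMod b, (sliceFn b J c κ e i W₀ ^ b) ^ ((b : ℝ)⁻¹) = ∏ i : ZMod b, sliceFn b J c κ e i W₀ :=
      Finset.prod_congr rfl fun i _ => Real.pow_rpow_inv_natCast (hS i) (NeZero.ne b)
    rw [hgeo] at hamgm
    have hrest := restFn_oneLink_pos b hb J κ e ((0 : Site d (b * L)), μ) h1 hg₁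
    have hGeq : G W₀ = restFn b J c κ e W₀ *
        (∑ i : ZMod b, (b : ℝ)⁻¹ * sliceFn b J c κ e i W₀ ^ b - ∏ i : ZMod b, sliceFn b J c κ e i W₀) := by
      rw [hG]
      simp only []
      simp_rw [powFieldFn_sliceExp]
      rw [powFieldFn_eq_rest_mul_prod_slice b J c κ e W₀, mul_sub, Finset.mul_sum]
      congr 1
      exact Finset.sum_congr rfl fun i _ => by ring
    rw [hGeq]
    exact mul_pos hrest (sub_pos.2 hamgm)
  -- the product Haar measure charges open sets: the gap has positive integral
  have hGint : 0 < ∫ W, G W ∂P := by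
    haveI : (haarProbability SU2).IsOpenPosMeasure := by unfold haarProbability; infer_instance
    haveI := Literature.MathematicalPhysics.QuantumLattice.secondCountableTopology_su2
    exact hGc.integral_pos_of_hasCompactSupport_nonneg_nonzero (HasCompactSupport.of_compactSpace _) hG0 hGW₀.ne'
  -- assemble: `∫ G = Z(move_κ 1) - Z(1)`
  have hGI : ∫ W, G W ∂P = powFieldZ J c (moveExp b κ e) - powFieldZ J c e := by
    have hsum : Integrable (fun W => ∑ i : ZMod b, (b : ℝ)⁻¹ * powFieldFn J c (sliceExp b κ e i) W) P :=
      integrable_finsetSum _ fun i _ => (hint _).const_mul _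
    rw [hG, integral_sub hsum (hint e), integral_finsetSum _ fun i _ => (hint _).const_mul _]
    have hterm : ∀ i : ZMod b, ∫ W, (b : ℝ)⁻¹ * powFieldFn J c (sliceExp b κ e i) W ∂P =
        (b : ℝ)⁻¹ * powFieldZ J c (moveExp b κ e) := by
      intro i
      rw [integral_const_mul, sliceExp_eq_moveExp_comp_plaqShift b κ (fun p => rfl) i]
      congr 1
      exact powFieldZ_comp_plaqShift J c (moveExp b κ e) _
    · rw [Finset.sum_congr rfl fun i _ => hterm i, Finset.sum_const, Finset.card_univ, ZMod.card, nsmul_eq_mul,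
        ← mul_assoc, mul_inv_cancel₀ (Nat.cast_ne_zero.2 (NeZero.ne b)), one_mul]
      rfl
  rw [hGI] at hGint
  linarith

/-- **STRICT potential moving** (the inequality half of arXiv:0707.2179 Prop. III.1 is strict off the trivial case):
for `d ≥ 3`, `b ≥ 2`, every `L ≥ 1` and `J`, on the positivity domain `f_c ≥ 0` with some `c_n > 0` (`1 ≤ n ≤ J`,
all `c_n ≥ 0`), `Z_{(ℤ/bL)^d}({c_j}) < ∫ ∏_{p on the coarse 2-skeleton} f_c(U_p)^{b^{d-2}} ∏ dU`. -/
theorem torusZ_fine_lt_powFieldZ_mkExp (hd : 3 ≤ d) (hb : 2 ≤ b) (J : ℕ) {c : ℕ → ℝ} (hc : ∀ n, 1 ≤ n → 0 ≤ c n)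
    (hf : ∀ g : SU2, 0 ≤ plaqFn J c g) {n₀ : ℕ} (hn₀ : n₀ ∈ Icc 1 J) (hpos : 0 < c n₀) :
    torusZ d (b * L) J c <
      powFieldZ J c (fun p : Plaquette d (b * L) =>
        if ∀ κ ∈ perpDirs p, resb b L (p.1 κ) = 0 then b ^ (d - 2) else 0) := by
  set κ : Fin d := ⟨2, by omega⟩ with hκdef
  have hfun : mkExpS (L := L) b (univ : Finset (Fin d)) = fun p : Plaquette d (b * L) =>
      if ∀ κ ∈ perpDirs p, resb b L (p.1 κ) = 0 then b ^ (d - 2) else 0 := funext fun p => mkExpS_univ b p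
  calc torusZ d (b * L) J c = powFieldZ J c (fun _ : Plaquette d (b * L) => 1) := torusZ_eq_powFieldZ_one J c
    _ < powFieldZ J c (moveExp b κ (fun _ : Plaquette d (b * L) => 1)) :=
        powFieldZ_one_lt_moveExp b hd hb J hc hf hn₀ hpos
    _ = powFieldZ J c (mkExpS (L := L) b ({κ} : Finset (Fin d))) := by
        rw [← mkExpS_empty (L := L) b, moveExp_mkExpS b (Finset.notMem_empty κ), Finset.insert_empty]
    _ ≤ powFieldZ J c (mkExpS (L := L) b (univ : Finset (Fin d))) := powFieldZ_mkExpS_le_univ b J hf {κ}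
    _ = _ := by rw [hfun]

end StrictMove

end Summit.Ventures.YMGap.Census

end
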